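import Summits.CriticalPhenomena.SAWScalingLimit.Theorems.SAWLoopFugacityFlowAvoidanceLimitAnchorDefs
import Summits.CriticalPhenomena.SAWScalingLimit.Theorems.SAWLoopFugacityFlowAvoidanceLimitSawEndpoint
import Summits.CriticalPhenomena.SAWScalingLimit.Theorems.SAWLoopFugacityFlowAvoidanceLimitMassiveBelow
import Literature.Probability.RandomPlanarGeometry.SupercriticalSAWPolygons
import Literature.Probability.RandomPlanarGeometry.SupercriticalSAWProp3Holds
import Literature.Probability.RandomPlanarGeometry.SelfAvoidingWalkProofs

/-!
# Above `x_c` the corner-to-corner square crossing is not massive — stub `stub_notMassiveAbove`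
of line `saw-corner-germ` (crux `SAWLoopFugacityFlow.AvoidanceLimit`, stmt-CriticalPhenomena-10649)

For the `(n, t) = (0, 0)` slice of the Anchor family (the plain self-avoiding walk) and a fugacity
`x > x_c = 1/μ`, the corner-to-corner two-leg function of the lattice square `[0, k]²`,
`A_k(x) := twoLegDim 0 0 x ℤ² [0,k]² 0 (k,k) = Σ_{γ} x^{|γ|}` over the DKY "squared walks" of span
`k` (`Anchor.twoLegDim_zero_zero_eq_sum_paths`), is NOT eventually `≤ e^{-mk}` for any `m > 0`.

Proof (Duminil-Copin–Kozma–Yadin 2014, §2, the argument of Proposition 3 before the polygon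
gluing, entirely from tree theorems): with `ρ := xμ > 1`, DKY Lemma 5 (`SAW.DKY2014_lem5_holds`:
`a_n ≥ μⁿ e^{-c√n}` for even `n`) and the pigeonhole over the endpoints
(`SAW.exists_span_squaredWalkCount_le`) give, for every even `n`, a span `s = s(n)` carrying
`≥ a_n / (2n+1)²` squared walks of length `n`; each of them is a self-avoiding path of `ℤ²` from
`0` to `(s, s)` inside `[0, s]²` (`squaredWalksOfSpan_subset_pathsIn`), so
`A_s(x) ≥ #{…} · xⁿ ≥ ρⁿ e^{-c√n} / (2n+1)² → ∞` (`SAW.tendsto_pow_mul_exp_neg_sqrt_div`), while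
`s(n) → ∞` because a squared walk of length `n` and span `s` has `n + 1 ≤ (s+1)²` vertices
(`SAW.succ_le_sq_of_mem_squaredWalksOfSpan`). This is incompatible with `A_s(x) ≤ e^{-ms} ≤ 1`
for all large `s`.

Sources: H. Duminil-Copin, G. Kozma, A. Yadin, Ann. IHP Probab. Stat. 50 (2014), §2, Lemma 5 and
the proof of Proposition 3 [DuminilCopinKozmaYadin2014]; N. Madras, G. Slade, *The Self-Avoiding
Walk* (1993), §1.2 [MadrasSlade1993]. No new definitions; `Corner.zero_ne_diag` is imported from the
sibling stub file `…MassiveBelow.lean`. (Non-massiveness AT `x_c` — Madras 1995 — is not asserted here.)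
-/

noncomputable section

open Set Filter Topology
open Literature.Probability.RandomPlanarGeometry Literature.Probability.LatticeModels
open Summit.CriticalPhenomena.SAWScalingLimit.Theorems.AvoidanceLimit.Anchor

namespace Summit.CriticalPhenomena.SAWScalingLimit.Theorems.AvoidanceLimit.Corner

/-- A squared walk of length `n` and span `k` (DKY 2014, §2) is a self-avoiding path of `ℤ²` from
`0` to `(k, k)` all of whose vertices lie in the lattice square `[0, k]² = {v ∈ box 2 k | 0 ≤ v}`. -/
theorem squaredWalksOfSpan_subset_pathsIn (n k : ℕ) :
    SAW.squaredWalksOfSpan n k ⊆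
      DiluteLoopModel.pathsIn (zdGraph 2) ((box 2 k).filter fun v => ∀ i, 0 ≤ v i) 0
        (SAW.diag k) := by
  intro p hp
  obtain ⟨-, hsq⟩ := SAW.mem_squaredWalksOfSpan.1 hp
  obtain ⟨hpath, hb⟩ := SAW.SquaredWalkPolygon.isSq_of_isSquaredWalk hsq
  rw [DiluteLoopModel.mem_pathsIn]
  refine ⟨hpath, fun w hw => ?_⟩
  rw [Finset.mem_filter, mem_box]
  refine ⟨fun i => ⟨?_, (hb w hw i).2⟩, fun i => (hb w hw i).1⟩
  have h1 := (hb w hw i).1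
  omega

/-- **The squared walks of one length bound the two-leg function from below**: for `k ≥ 1` and
`x ≥ 0`, `#{squared walks of span k and length n} · xⁿ ≤ A_k(x) = twoLegDim 0 0 x ℤ² [0,k]² 0 (k,k)`
(the latter is `Σ_γ x^{|γ|}` over ALL self-avoiding paths from `0` to `(k,k)` inside `[0,k]²`,
`Anchor.twoLegDim_zero_zero_eq_sum_paths`, a sum of nonnegative terms; `0 ≠ (k,k)` is the sibling
file's `Corner.zero_ne_diag`). -/
theorem card_mul_pow_le_twoLegDim {x : ℝ} (hx : 0 ≤ x) (n : ℕ) {k : ℕ} (hk : 1 ≤ k) :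
    ((SAW.squaredWalksOfSpan n k).card : ℝ) * x ^ n ≤
      twoLegDim (0 : ℝ) 0 x (zdGraph 2) ((box 2 k).filter fun v => ∀ i, 0 ≤ v i) 0
        (SAW.diag k) := by
  rw [twoLegDim_zero_zero_eq_sum_paths le_rfl x _ (zero_ne_diag hk)]
  calc ((SAW.squaredWalksOfSpan n k).card : ℝ) * x ^ n
      = ∑ p ∈ SAW.squaredWalksOfSpan n k, x ^ p.length := by
        rw [Finset.sum_congr rfl fun p hp => by rw [(SAW.mem_squaredWalksOfSpan.1 hp).1],
          Finset.sum_const, nsmul_eq_mul]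
    _ ≤ ∑ p ∈ DiluteLoopModel.pathsIn (zdGraph 2) ((box 2 k).filter fun v => ∀ i, 0 ≤ v i) 0
          (SAW.diag k), x ^ p.length :=
        Finset.sum_le_sum_of_subset_of_nonneg (squaredWalksOfSpan_subset_pathsIn n k)
          fun _ _ _ => pow_nonneg hx _

/-- **STUB 1b of line `saw-corner-germ` · `NotMassiveAbove`.** For every fugacity `x > x_c = 1/μ`
the corner-to-corner two-leg function `A_k(x) = twoLegDim 0 0 x ℤ² [0,k]² 0 (k,k)` of the plain SAW
across the lattice square is not eventually `≤ e^{-mk}`, whatever `m > 0`: by DKY 2014 Lemma 5 and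
the pigeonhole on the span, for every large even `n` some span `s(n) → ∞` has
`A_{s(n)}(x) ≥ (xμ)ⁿ e^{-c√n} / (2n+1)² → ∞`, whereas massiveness would force `A_s(x) ≤ 1` for all
large `s`. -/
theorem stub_notMassiveAbove :
    ∀ x : ℝ, SAW.criticalFugacity < x → ¬ ∃ m : ℝ, 0 < m ∧ ∀ᶠ k : ℕ in atTop,
      twoLegDim (0 : ℝ) 0 x (zdGraph 2) ((box 2 k).filter fun v => ∀ i, 0 ≤ v i) 0 (SAW.diag k) ≤
        Real.exp (-(m * k)) := by
  intro x hx
  rintro ⟨m, hm, hev⟩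
  obtain ⟨K, hK⟩ := eventually_atTop.1 hev
  obtain ⟨c, hc⟩ := SAW.DKY2014_lem5_holds
  -- constants: `μ > 0`, `x > 0`, `ρ = xμ > 1`
  have hxc : 0 < SAW.criticalFugacity := SAW.criticalFugacity_pos_lt_one'.1
  have hμ : 0 < SAW.connectiveConstant := by
    have h := hxc
    rwa [SAW.criticalFugacity, inv_pos] at h
  have hx0 : 0 < x := hxc.trans hx
  have hρ : 1 < x * SAW.connectiveConstant := by
    have h := mul_lt_mul_of_pos_right hx hμ
    rwa [SAW.criticalFugacity, inv_mul_cancel₀ hμ.ne'] at h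
  -- the lower bound `(xμ)ⁿ e^{-c√n} / (2n+1)²` exceeds `1` for all large `n`
  obtain ⟨n₀, hn₀⟩ := eventually_atTop.1
    ((SAW.tendsto_pow_mul_exp_neg_sqrt_div hρ c).eventually_gt_atTop 1)
  -- an even `n` beyond `n₀` and `(K+1)²`
  set n : ℕ := 2 * max n₀ ((K + 1) ^ 2) with hn
  have hn_ge₀ : n₀ ≤ n := by omega
  have hn_geK : (K + 1) ^ 2 ≤ n := by omega
  have hn_even : Even n := ⟨max n₀ ((K + 1) ^ 2), by omega⟩
  have hTn : 1 < (x * SAW.connectiveConstant) ^ n * Real.exp (-(c * Real.sqrt n)) /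
      (2 * n + 1) ^ 2 := hn₀ n hn_ge₀
  -- Lemma 5 at `n`, and a span `s` carrying at least the average number of squared walks
  have h5n := hc n hn_even
  have hapos : (0 : ℝ) < SAW.squaredWalkCount n :=
    lt_of_lt_of_le (mul_pos (pow_pos hμ n) (Real.exp_pos _)) h5n
  obtain ⟨s, hs, hne⟩ := SAW.exists_span_squaredWalkCount_le n
  obtain ⟨p, hp⟩ := hne (by exact_mod_cast hapos)
  -- the span is large: `(K+1)² ≤ n < n + 1 ≤ (s+1)²`
  have hsK : K ≤ s ∧ 1 ≤ s := by
    have h1 := SAW.succ_le_sq_of_mem_squaredWalksOfSpan hp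
    have hlt : (K + 1) ^ 2 < (s + 1) ^ 2 := by omega
    have h2 := (Nat.pow_lt_pow_iff_left two_ne_zero).1 hlt
    omega
  -- massiveness at span `s`: `A_s(x) ≤ e^{-ms} ≤ 1`
  have hup : twoLegDim (0 : ℝ) 0 x (zdGraph 2) ((box 2 s).filter fun v => ∀ i, 0 ≤ v i) 0
      (SAW.diag s) ≤ 1 := by
    refine (hK s hsK.1).trans ?_
    rw [Real.exp_le_one_iff]
    have h0 : (0 : ℝ) ≤ m * s := by positivity
    linarith
  -- Lemma 5 at span `s`: `A_s(x) ≥ #{squared walks} xⁿ ≥ (xμ)ⁿ e^{-c√n} / (2n+1)²`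
  have hlow : (x * SAW.connectiveConstant) ^ n * Real.exp (-(c * Real.sqrt n)) / (2 * n + 1) ^ 2 ≤
      twoLegDim (0 : ℝ) 0 x (zdGraph 2) ((box 2 s).filter fun v => ∀ i, 0 ≤ v i) 0
        (SAW.diag s) := by
    have hS : (SAW.squaredWalkCount n : ℝ) ≤ (2 * n + 1) ^ 2 * (SAW.squaredWalksOfSpan n s).card := by
      exact_mod_cast hs
    have hden0 : (0 : ℝ) < (2 * n + 1) ^ 2 := by positivity
    have h1 : SAW.connectiveConstant ^ n * Real.exp (-(c * Real.sqrt n)) / (2 * n + 1) ^ 2 ≤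
        (SAW.squaredWalksOfSpan n s).card := by
      rw [div_le_iff₀ hden0]
      linarith
    calc (x * SAW.connectiveConstant) ^ n * Real.exp (-(c * Real.sqrt n)) / (2 * n + 1) ^ 2
        = SAW.connectiveConstant ^ n * Real.exp (-(c * Real.sqrt n)) / (2 * n + 1) ^ 2 * x ^ n := by
          rw [mul_pow]; ring
      _ ≤ (SAW.squaredWalksOfSpan n s).card * x ^ n :=
          mul_le_mul_of_nonneg_right h1 (pow_nonneg hx0.le _)
      _ ≤ _ := card_mul_pow_le_twoLegDim hx0.le n hsK.2
  linarith

end Summit.CriticalPhenomena.SAWScalingLimit.Theorems.AvoidanceLimit.Corner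

end
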